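import Summits.CriticalPhenomena.PercolationContinuityZ3.Theorems.PercNearOneGluingNoHeavyLowerTailSahiSubsetChordReduction
import Literature.Combinatorics.Sahi2008.UniformCube
import Literature.Combinatorics.Sahi2008.FKG
import Literature.Combinatorics.Sahi2008.Symmetry
import Mathlib.Logic.Equiv.Prod
import Mathlib.Tactic.Linarith
import Mathlib.Tactic.Ring
import HarnessLib

/-!
# `NoHeavyLowerTail` (stmt-CriticalPhenomena-4575) — the CONDITIONING PENALTY bound for Sahi's `E₃` on product cubes

Support file, seat `prim-l12-p5` (gen 3), `--supports stmt-CriticalPhenomena-4575`.  No definitions, no named facts, no sorries.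

Setting: finite product cube `ι → Bool` with product weight `w_q`, three NONNEGATIVE MONOTONE functions `F₀, F₁, F₂` (indicators of
up-sets in the applications), a set `S` of coordinates, and the section sum
`Z_S := Σ_v w_S(v) · E₃(F | x_S = v)` (expected `E₃` of the sections at `x_S`; the left side of `SubsetChordSuperlinear`, whose
`S = univ ∖ {j}` instance is the co-singleton sum of `HalfCoSingletonBound`).

**THEOREM (`sectionSum_le_sahiE_add`, all `S`, all three slots by `sectionSum_le_sahiE_add_slot`):**
  `Z_S ≤ E₃(F) + E F_a · Cov(F_b, F_c)`,  equivalently  `Z_S ≤ 2E(F₀F₁F₂) − E F_b·E(F_aF_c) − E F_c·E(F_aF_b)`: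
conditioning on ANY set of coordinates raises the expected Sahi functional by at most the smallest of the three mean-weighted pair
covariances.  Proof (three lines): per fibre `E₃ = Cov(F_b, F_aF_c) + Cov(F_c, F_aF_b) − E F_a·Cov(F_b,F_c)` (covariance form), the last
term is `≤ 0` by Harris on the fibre; summing, each `E_v[Cov_v(·,·)]` of two increasing functions is at most the unconditional covariance
(law of total covariance + Harris for the conditional means on the `S`-cube).

Consequences recorded here: `sectionSum_le_sahiE_of_uncorrelated` — if some two slots are uncorrelated (`E(F_bF_c) ≤ E F_b·E F_c`, e.g.
disjoint supports) then EVERY `S` satisfies the subset-chord inequality `Z_S ≤ E₃(F)` (so `SubsetChordSuperlinear`, `CoSingletonBound` at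
every `j` and `HalfCoSingletonBound` hold on that class outright); and (companion file `…SahiHalfCoSingletonComparableSections`) for a
comparable pair `F_a ≤ F_b` one has `E F_b·Cov(F_a,F_c) ≤ E₃`, hence `Z_S ≤ 2E₃` for every `S`.  For general triples `E₃` does NOT dominate
`min_a E F_a·Cov(F_b,F_c)` (exact witness, P5-REPORT §3h(t): `([x₃],[x₀x₁∨x₁x₂∨x₁x₃],[x₀x₁∨x₂∨x₀x₃])` at `q = (1/2, 49/50, 199/200, 19/20)`
has `Z_{{2}} = 200·E₃`, so `min_a E F_a·Cov ≥ 199·E₃` there) — the half-co-singleton bound is a different statement.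
Plumbing: `glue_mono_left`, `prodWeight_glue`, `sum_eq_sum_sum_glue`, `ex_prodWeight_eq_sum_glue` (Fubini for the `S`-split).
Exact check of the theorem (seat, `code/zs_general_bound.py`): all triples on `k ≤ 3` coins × all `S` × 6 weight vectors and 1 500 sampled
`k = 4` triples × all `S` × 5 vectors (509 184 cells): `0` violations, minimal slack exactly `0`.
-/

namespace Summit.CriticalPhenomena.PercolationContinuityZ3.Theorems

namespace SahiSubsetChord

open Finset Literature.Combinatorics.Sahi2008

variable {ι : Type*} [Fintype ι] [DecidableEq ι]

omit [Fintype ι] in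
/-- Gluing is monotone in the `S`-coordinates as well. [folklore] -/
theorem glue_mono_left (S : Finset ι) (y : {i // i ∉ S} → Bool) : Monotone (fun v => glue S v y) := by
  intro v v' h i
  dsimp only [glue]
  split_ifs with hi
  · exact h ⟨i, hi⟩
  · exact le_rfl

/-- The product weight of a glued configuration is the product of the two marginal product weights. [folklore] -/
theorem prodWeight_glue (q : ι → ℝ) (S : Finset ι) (v : {i // i ∈ S} → Bool) (y : {i // i ∉ S} → Bool) :
    prodWeight q (glue S v y)
      = prodWeight (fun i : {i // i ∈ S} => q i) v * prodWeight (fun i : {i // i ∉ S} => q i) y := by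
  unfold prodWeight
  have key := Fintype.prod_subtype_mul_prod_subtype (M := ℝ) (fun i : ι => i ∈ S)
    (fun i : ι => if glue S v y i then q i else 1 - q i)
  rw [← key]
  congr 1
  · refine Finset.prod_congr (by ext; simp) fun i _ => ?_
    simp only [glue, dif_pos i.2, Subtype.coe_eta]
  · refine Finset.prod_congr (by ext; simp) fun i _ => ?_
    simp only [glue, dif_neg i.2, Subtype.coe_eta]

/-- **Fubini for the `S`-split of the cube**: `Σ_x F(x) = Σ_v Σ_y F(glue S v y)`. [folklore] -/
theorem sum_eq_sum_sum_glue (S : Finset ι) (F : (ι → Bool) → ℝ) :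
    ∑ x, F x = ∑ v : ({i // i ∈ S} → Bool), ∑ y : ({i // i ∉ S} → Bool), F (glue S v y) := by
  rw [← (Equiv.piEquivPiSubtypeProd (fun i => i ∈ S) (fun _ => Bool)).symm.sum_comp, Fintype.sum_prod_type]
  rfl

/-- The expectation under a product weight, split along `S`: `E F = Σ_v w_S(v) · E_{w_{Sᶜ}}[y ↦ F(glue S v y)]`. [folklore] -/
theorem ex_prodWeight_eq_sum_glue (q : ι → ℝ) (S : Finset ι) (F : (ι → Bool) → ℝ) :
    ex (prodWeight q) F = ∑ v : ({i // i ∈ S} → Bool), prodWeight (fun i : {i // i ∈ S} => q i) v *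
      ex (prodWeight fun i : {i // i ∉ S} => q i) (fun y => F (glue S v y)) := by
  unfold ex
  rw [sum_eq_sum_sum_glue S]
  refine Finset.sum_congr rfl fun v _ => ?_
  rw [Finset.mul_sum]
  refine Finset.sum_congr rfl fun y _ => ?_
  rw [prodWeight_glue]
  ring

/-- **Conditioning penalty, moment form.**  For nonnegative monotone `F₀, F₁, F₂` on a finite product cube and every coordinate set
`S`: `Σ_v w_S(v)·E₃(sections of F at x_S = v) ≤ 2E(F₀F₁F₂) − E F₁·E(F₀F₂) − E F₂·E(F₀F₁)`. [this file] -/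
theorem sectionSum_le_moments (q : ι → ℝ) (hq : ∀ i, 0 ≤ q i ∧ q i ≤ 1) (F : Fin 3 → (ι → Bool) → ℝ)
    (hF0 : ∀ a x, 0 ≤ F a x) (hFm : ∀ a, Monotone (F a)) (S : Finset ι) :
    ∑ v : ({i // i ∈ S} → Bool), prodWeight (fun i : {i // i ∈ S} => q i) v *
        sahiE (prodWeight fun i : {i // i ∉ S} => q i) 3 (fun a y => F a (glue S v y))
      ≤ 2 * ex (prodWeight q) (F 0 * F 1 * F 2) - ex (prodWeight q) (F 1) * ex (prodWeight q) (F 0 * F 2)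
          - ex (prodWeight q) (F 2) * ex (prodWeight q) (F 0 * F 1) := by
  set wS : ({i // i ∈ S} → Bool) → ℝ := prodWeight (fun i : {i // i ∈ S} => q i) with hwS
  set wT : ({i // i ∉ S} → Bool) → ℝ := prodWeight (fun i : {i // i ∉ S} => q i) with hwT
  have hwS0 : ∀ v, 0 ≤ wS v := fun v => prodWeight_nonneg (q := fun i : {i // i ∈ S} => q i) (fun i => hq i) v
  have hwT0 : ∀ y, 0 ≤ wT y := fun y => prodWeight_nonneg (q := fun i : {i // i ∉ S} => q i) (fun i => hq i) y
  have hFKGS : IsFKGMeasure wS := isFKGMeasure_coinWeight (fun i => hq i)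
  have hFKGT : IsFKGMeasure wT := isFKGMeasure_coinWeight (fun i => hq i)
  -- fibre quantities: means and mixed moments of the sections at x_S = v
  set a0 : (({i // i ∈ S} → Bool)) → ℝ := fun v => ex wT (fun y => F 0 (glue S v y)) with ha0
  set a1 : (({i // i ∈ S} → Bool)) → ℝ := fun v => ex wT (fun y => F 1 (glue S v y)) with ha1
  set a2 : (({i // i ∈ S} → Bool)) → ℝ := fun v => ex wT (fun y => F 2 (glue S v y)) with ha2
  set m12 : (({i // i ∈ S} → Bool)) → ℝ := fun v => ex wT (fun y => (F 1 * F 2) (glue S v y)) with hm12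
  set m02 : (({i // i ∈ S} → Bool)) → ℝ := fun v => ex wT (fun y => (F 0 * F 2) (glue S v y)) with hm02
  set m01 : (({i // i ∈ S} → Bool)) → ℝ := fun v => ex wT (fun y => (F 0 * F 1) (glue S v y)) with hm01
  set m012 : (({i // i ∈ S} → Bool)) → ℝ := fun v => ex wT (fun y => (F 0 * F 1 * F 2) (glue S v y)) with hm012
  -- global moments split along S (Fubini)
  have e1 : ex (prodWeight q) (F 1) = ∑ v, wS v * a1 v := ex_prodWeight_eq_sum_glue q S (F 1)
  have e2 : ex (prodWeight q) (F 2) = ∑ v, wS v * a2 v := ex_prodWeight_eq_sum_glue q S (F 2)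
  have e02 : ex (prodWeight q) (F 0 * F 2) = ∑ v, wS v * m02 v := ex_prodWeight_eq_sum_glue q S (F 0 * F 2)
  have e01 : ex (prodWeight q) (F 0 * F 1) = ∑ v, wS v * m01 v := ex_prodWeight_eq_sum_glue q S (F 0 * F 1)
  have e012 : ex (prodWeight q) (F 0 * F 1 * F 2) = ∑ v, wS v * m012 v :=
    ex_prodWeight_eq_sum_glue q S (F 0 * F 1 * F 2)
  -- per fibre: E₃ of the sections, and Harris for (F₁, F₂) on the fibre
  have hsec : ∀ v, sahiE wT 3 (fun a y => F a (glue S v y))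
      = 2 * m012 v + a0 v * a1 v * a2 v - (a0 v * m12 v + a1 v * m02 v + a2 v * m01 v) := by
    intro v
    rw [sahiE_three_apply]
    rfl
  have hfib : ∀ v, a1 v * a2 v ≤ m12 v := fun v =>
    ex_mul_ex_le_ex_mul hFKGT (f := fun y => F 1 (glue S v y)) (g := fun y => F 2 (glue S v y))
      (fun y => hF0 1 _) (fun y => hF0 2 _) ((hFm 1).comp (glue_mono S v)) ((hFm 2).comp (glue_mono S v))
  have ha0v : ∀ v, 0 ≤ a0 v := fun v => ex_nonneg hwT0 (fun y => hF0 0 _)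
  have hpt : ∀ v, wS v * sahiE wT 3 (fun a y => F a (glue S v y))
      ≤ wS v * (2 * m012 v - a1 v * m02 v - a2 v * m01 v) := by
    intro v
    rw [hsec v]
    refine mul_le_mul_of_nonneg_left ?_ (hwS0 v)
    have := mul_nonneg (ha0v v) (sub_nonneg.mpr (hfib v))
    linarith only [this]
  -- Harris on the S-cube for the increasing conditional moments
  have ma1 : Monotone a1 := fun v v' hvv' => ex_mono hwT0 fun y => hFm 1 (glue_mono_left S y hvv')
  have ma2 : Monotone a2 := fun v v' hvv' => ex_mono hwT0 fun y => hFm 2 (glue_mono_left S y hvv')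
  have mm02 : Monotone m02 := fun v v' hvv' => ex_mono hwT0 fun y =>
    mul_le_mul (hFm 0 (glue_mono_left S y hvv')) (hFm 2 (glue_mono_left S y hvv')) (hF0 2 _) (hF0 0 _)
  have mm01 : Monotone m01 := fun v v' hvv' => ex_mono hwT0 fun y =>
    mul_le_mul (hFm 0 (glue_mono_left S y hvv')) (hFm 1 (glue_mono_left S y hvv')) (hF0 1 _) (hF0 0 _)
  have ha1v : ∀ v, 0 ≤ a1 v := fun v => ex_nonneg hwT0 (fun y => hF0 1 _)
  have ha2v : ∀ v, 0 ≤ a2 v := fun v => ex_nonneg hwT0 (fun y => hF0 2 _)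
  have hm02v : ∀ v, 0 ≤ m02 v := fun v => ex_nonneg hwT0 (fun y => mul_nonneg (hF0 0 _) (hF0 2 _))
  have hm01v : ∀ v, 0 ≤ m01 v := fun v => ex_nonneg hwT0 (fun y => mul_nonneg (hF0 0 _) (hF0 1 _))
  have H1 : (∑ v, wS v * a1 v) * (∑ v, wS v * m02 v) ≤ ∑ v, wS v * (a1 v * m02 v) := by
    have key := ex_mul_ex_le_ex_mul hFKGS (f := a1) (g := m02) ha1v hm02v ma1 mm02
    simpa [ex, Pi.mul_apply] using key
  have H2 : (∑ v, wS v * a2 v) * (∑ v, wS v * m01 v) ≤ ∑ v, wS v * (a2 v * m01 v) := by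
    have key := ex_mul_ex_le_ex_mul hFKGS (f := a2) (g := m01) ha2v hm01v ma2 mm01
    simpa [ex, Pi.mul_apply] using key
  -- assemble
  have hsum : ∑ v, wS v * sahiE wT 3 (fun a y => F a (glue S v y))
      ≤ ∑ v, wS v * (2 * m012 v - a1 v * m02 v - a2 v * m01 v) := Finset.sum_le_sum fun v _ => hpt v
  have hexp : ∑ v, wS v * (2 * m012 v - a1 v * m02 v - a2 v * m01 v)
      = 2 * (∑ v, wS v * m012 v) - (∑ v, wS v * (a1 v * m02 v)) - (∑ v, wS v * (a2 v * m01 v)) := by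
    rw [Finset.mul_sum, ← Finset.sum_sub_distrib, ← Finset.sum_sub_distrib]
    exact Finset.sum_congr rfl fun v _ => by ring
  rw [e1, e2, e02, e01, e012]
  linarith [hsum, hexp, H1, H2]

/-- **Conditioning penalty.**  For nonnegative monotone `F₀, F₁, F₂` on a finite product cube and EVERY coordinate set `S`:
`Σ_v w_S(v)·E₃(sections at x_S = v) ≤ E₃(F) + E F₀·(E(F₁F₂) − E F₁·E F₂)` — conditioning raises the expected `E₃` by at most
`E F₀ · Cov(F₁, F₂)`. [this file] -/
theorem sectionSum_le_sahiE_add (q : ι → ℝ) (hq : ∀ i, 0 ≤ q i ∧ q i ≤ 1) (F : Fin 3 → (ι → Bool) → ℝ)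
    (hF0 : ∀ a x, 0 ≤ F a x) (hFm : ∀ a, Monotone (F a)) (S : Finset ι) :
    ∑ v : ({i // i ∈ S} → Bool), prodWeight (fun i : {i // i ∈ S} => q i) v *
        sahiE (prodWeight fun i : {i // i ∉ S} => q i) 3 (fun a y => F a (glue S v y))
      ≤ sahiE (prodWeight q) 3 F
        + ex (prodWeight q) (F 0) * (ex (prodWeight q) (F 1 * F 2) - ex (prodWeight q) (F 1) * ex (prodWeight q) (F 2)) := by
  have h := sectionSum_le_moments q hq F hF0 hFm S
  rw [sahiE_three_apply]
  linarith [h]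

/-- **Conditioning penalty, any distinguished slot.**  For nonnegative monotone `F` and pairwise distinct slots `a, b, c`:
`Z_S ≤ E₃(F) + E F_a·(E(F_bF_c) − E F_b·E F_c)` for every `S`. [this file] -/
theorem sectionSum_le_sahiE_add_slot (q : ι → ℝ) (hq : ∀ i, 0 ≤ q i ∧ q i ≤ 1) (F : Fin 3 → (ι → Bool) → ℝ)
    (hF0 : ∀ a x, 0 ≤ F a x) (hFm : ∀ a, Monotone (F a)) (σ : Equiv.Perm (Fin 3)) (S : Finset ι) :
    ∑ v : ({i // i ∈ S} → Bool), prodWeight (fun i : {i // i ∈ S} => q i) v *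
        sahiE (prodWeight fun i : {i // i ∉ S} => q i) 3 (fun a y => F a (glue S v y))
      ≤ sahiE (prodWeight q) 3 F
        + ex (prodWeight q) (F (σ 0)) *
          (ex (prodWeight q) (F (σ 1) * F (σ 2)) - ex (prodWeight q) (F (σ 1)) * ex (prodWeight q) (F (σ 2))) := by
  have key := sectionSum_le_sahiE_add q hq (fun a => F (σ a)) (fun a x => hF0 _ x) (fun a => hFm _) S
  have hsecσ : ∀ v : ({i // i ∈ S} → Bool),
      sahiE (prodWeight fun i : {i // i ∉ S} => q i) 3 (fun a y => F (σ a) (glue S v y))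
        = sahiE (prodWeight fun i : {i // i ∉ S} => q i) 3 (fun a y => F a (glue S v y)) := fun v =>
    sahiE_comp_perm _ 3 σ (fun a y => F a (glue S v y))
  simp only [hsecσ] at key
  rw [sahiE_comp_perm (prodWeight q) 3 σ F] at key
  exact key

/-- **An uncorrelated pair makes every conditioning set good.**  If `E(F_bF_c) ≤ E F_b·E F_c` for two distinct slots (e.g. functions
of disjoint sets of coordinates), then for EVERY `S` the subset-chord inequality `Z_S ≤ E₃(F)` holds. [this file] -/
theorem sectionSum_le_sahiE_of_uncorrelated (q : ι → ℝ) (hq : ∀ i, 0 ≤ q i ∧ q i ≤ 1) (F : Fin 3 → (ι → Bool) → ℝ)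
    (hF0 : ∀ a x, 0 ≤ F a x) (hFm : ∀ a, Monotone (F a)) (σ : Equiv.Perm (Fin 3))
    (hcov : ex (prodWeight q) (F (σ 1) * F (σ 2)) ≤ ex (prodWeight q) (F (σ 1)) * ex (prodWeight q) (F (σ 2)))
    (S : Finset ι) :
    ∑ v : ({i // i ∈ S} → Bool), prodWeight (fun i : {i // i ∈ S} => q i) v *
        sahiE (prodWeight fun i : {i // i ∉ S} => q i) 3 (fun a y => F a (glue S v y))
      ≤ sahiE (prodWeight q) 3 F := by
  have key := sectionSum_le_sahiE_add_slot q hq F hF0 hFm σ S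
  have ha : 0 ≤ ex (prodWeight q) (F (σ 0)) := ex_nonneg (fun x => prodWeight_nonneg hq x) (hF0 _)
  have := mul_nonneg ha (sub_nonneg.mpr hcov)
  nlinarith [key, this]

end SahiSubsetChord

end Summit.CriticalPhenomena.PercolationContinuityZ3.Theorems
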